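import Mathlib
import Summits.Ventures.HodgeRepro.Tier4.Common.ThetaLift
import Summits.Ventures.HodgeRepro.Tier4.Line4.TwoTorusCut

/-!
# Tier4/Line4/ThetaRungs — the rungs W1 and W3 of the L4 wall `mixed_two_torus` on the theta-lift vocabulary: the
span of the theta lifts of a kernel family is the candidate `V`, every PRINTED input is a DISPLAYED property of the
family, and the wall's conclusion follows through the cut's glue

Blind re-derivation cell `pub-hodge-repro`, Tier 4 «prove the step» (README §9–§10), seat t4-L4-p1 (gen 2; lead g385
ruling R-IV S12912: «W1 is lit-facing … successor t4-L4-p1 only once that vocabulary exists»; typer-2's vocabulary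
`Tier4/Common/ThetaLift.lean` S12914: `KernelFamily`, `thetaLift`, `thetaSpan`, `isAutomorphicSubspace_thetaSpan`).
Tree path `lean/Summits/Ventures/HodgeRepro/Tier4/Line4/ThetaRungs.lean`.  Imports the cut `Line4/TwoTorusCut.lean`
(p671784: `IsAdmissible`, `IsRieszVector`, `HasNonzeroMixedPeriod`, the glue `exists_spectrum_of_rungs`) and
`Common/ThetaLift.lean`.  GENERIC over any plane `W : PlaneData k` with RTF data `R` and any kernel family `F`.

WHAT IS PROVED.  With `V := thetaSpan F R.μT' R.DT' (conjChar W R.chi')` — the `ℂ`-span of the lifts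
`θ(χ̄′)(g) = ∫_{[T′]} Θ(t, g) χ̄′(t) dt`, `Θ` running over the family —:
* **transfer of a right-translation law from a kernel to its lift** (`thetaLift_mul_of_kernel`): if
  `Θ(t, x h) = c · Θ(t, x)` for every `t`, then `θ(x h) = c · θ(x)` (the integral is linear); hence a kernel that is
  `χ̄′`-equivariant in `g` under `T′(𝔸)` and whose lift is non-zero at `1` gives a **Riesz vector of `V`**
  (`isRieszVector_thetaLift`), and a kernel with the `K`-type law `(e₊, e₋)` at a real place `w` whose lift is non-zero
  gives the **`K`-type `(e₊, e₋)` of `V` at `w`** (`hasKTypeAt_thetaSpan_of_kernel`, primed twin for `T′`);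
* `V` is automorphic (typer-2's theorem) and non-zero as soon as one lift is (`thetaSpan_ne_bot`); on an anisotropic
  plane every subspace is cuspidal (`isCuspidalSubspace_of_isAnisotropic`);
* **the mixed period of a lift is the two-torus period of its kernel** (`mixedPeriod_thetaLift_eq`): for the
  restriction of `θ(χ̄′)` to `T(𝔸)`, `P_χ(θ(χ̄′)|_T) = P_χ (s ↦ P_{χ̄′} (t ↦ Θ(t, s)))` — the `Jc`-shaped double period
  of `AdelicRTF` applied to the kernel (the seesaw identity of L4-MATH.md §11 at the level of one kernel; DISPLAYED:
  integrability of `t ↦ χ̄′(t) Θ(t, s)` over `D_{T′}` for each `s`, so that both sides are the integrals);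
* **W1** (`exists_admissible_riesz_of_kernelFamily`): `∃ V, IsAdmissible … V ∧ ∃ f, IsRieszVector W R V f`, the
  EXISTENCE rung of the cut, from the DISPLAYED printed properties of the family — (i) a `χ̄′`-equivariant kernel with
  `θ(1) ≠ 0` (the Riesz vector; Siegel–Weil / Rallis), (ii) irreducibility of the span (Howe duality), (iii) cuspidality
  of the span (automatic when the plane is anisotropic), (iv) at every real place a kernel of the `K`-type `(eP w, eM w)`
  with non-zero lift (Ichino Lemma 7.8 / `LitKType`), (v) «lowest at `w₀`» for the span, (vi)–(vii) the primed twins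
  for the transported torus;
* **W3** (`exists_admissible_mixed_of_kernelFamily`): the same with (i) strengthened to a `χ̄′`-equivariant kernel with
  `θ(1) ≠ 0` AND non-zero `T`-period of its lift against `χ` — `∃ V, IsAdmissible … V ∧ HasNonzeroMixedPeriod W R V`,
  the SIMULTANEOUS clause of the cut; and **the wall's conclusion** (`exists_spectrum_of_kernelFamily`) through the
  cut's glue (`R.IsHaar`, `hunit` as in the cut).

WHAT IS NOT PROVED (the honest wall, narrowed once more): nothing here constructs a kernel family (the Weil
representation is not in the tree), and the non-vanishing `θ(χ̄′)(1) ≠ 0` / the non-zero mixed period of the lift are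
DISPLAYED — the wall `mixed_two_torus` now reads «for the seesaw plane there is a kernel family with the displayed
properties (i)–(vii) and a kernel whose two-torus period against `(χ, χ̄′)` is non-zero».

HC_CM is NOT proved by anyone in this repository.
-/

set_option autoImplicit false

noncomputable section

namespace Summit.Ventures.HodgeRepro.Tier4.Line4

open Summit.Ventures.HodgeRepro.Tier4.Common MeasureTheory NumberField

section Transfer

variable {k : Type} [Field k] [NumberField k] {W : PlaneData k} [MeasurableSpace (torusT' W)]

/-- **Transfer of a right-translation law from the kernel to its lift**: if `Θ(t, x h) = c · Θ(t, x)` for every `t`,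
then `θ(χ′)(x h) = c · θ(χ′)(x)`. -/
theorem thetaLift_mul_of_kernel (μ : Measure (torusT' W)) (D : Set (torusT' W)) (χ' : torusT' W → ℂ)
    (Θ : torusT' W → GA W → ℂ) {x h : GA W} {c : ℂ} (hΘ : ∀ t, Θ t (x * h) = c * Θ t x) :
    thetaLift μ D χ' Θ (x * h) = c * thetaLift μ D χ' Θ x := by
  simp only [thetaLift, hΘ, mul_assoc]
  exact integral_const_mul c _

/-- A lift with a non-zero value is a non-zero function. -/
theorem thetaLift_ne_zero_of_apply_ne_zero (μ : Measure (torusT' W)) (D : Set (torusT' W)) (χ' : torusT' W → ℂ)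
    (Θ : torusT' W → GA W → ℂ) {x : GA W} (hx : thetaLift μ D χ' Θ x ≠ 0) : thetaLift μ D χ' Θ ≠ 0 := by
  intro h0
  exact hx (by rw [h0]; rfl)

/-- The span of the lifts is non-zero as soon as one lift is. -/
theorem thetaSpan_ne_bot (F : KernelFamily W) (μ : Measure (torusT' W)) (D : Set (torusT' W))
    (χ' : torusT' W → ℂ) {Θ : torusT' W → GA W → ℂ} (hΘ : Θ ∈ F.carrier) (hne : thetaLift μ D χ' Θ ≠ 0) :
    thetaSpan F μ D χ' ≠ ⊥ :=
  Submodule.ne_bot_iff _ |>.2 ⟨_, thetaLift_mem_thetaSpan F μ D χ' hΘ, hne⟩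

/-- **The span is irreducible automorphic** when it is non-zero and has no proper non-zero automorphic subspace
(the latter DISPLAYED: Howe duality for the theta lift of a character, printed). -/
theorem isIrreducibleAutomorphic_thetaSpan (F : KernelFamily W) (μ : Measure (torusT' W)) (D : Set (torusT' W))
    (χ' : torusT' W → ℂ) {Θ : torusT' W → GA W → ℂ} (hΘ : Θ ∈ F.carrier) (hne : thetaLift μ D χ' Θ ≠ 0)
    (hmin : ∀ V₀ ≤ thetaSpan F μ D χ', IsAutomorphicSubspace W V₀ → V₀ = ⊥ ∨ V₀ = thetaSpan F μ D χ') :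
    IsIrreducibleAutomorphic W (thetaSpan F μ D χ') :=
  ⟨isAutomorphicSubspace_thetaSpan F μ D χ', thetaSpan_ne_bot F μ D χ' hΘ hne, hmin⟩

omit [MeasurableSpace (torusT' W)] in
/-- On an anisotropic plane every subspace is cuspidal (no isotropic line, no constant term to vanish). -/
theorem isCuspidalSubspace_of_isAnisotropic (h : IsAnisotropic W) (V : Submodule ℂ (GA W → ℂ)) :
    IsCuspidalSubspace W V :=
  fun f _ => isCuspidal_of_isAnisotropic W h f

/-- **`K`-type transfer**: a kernel of the family with the `K`-type law `(e₊, e₋)` at the real place `w` in its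
`g`-variable, whose lift is non-zero, gives `V` the `K`-type `(e₊, e₋)` at `w`. -/
theorem hasKTypeAt_thetaSpan_of_kernel (F : KernelFamily W) (μ : Measure (torusT' W)) (D : Set (torusT' W))
    (χ' : torusT' W → ℂ) (q : QuadData k) (w : InfinitePlace k) (ePlus eMinus : ℤ)
    {Θ : torusT' W → GA W → ℂ} (hΘ : Θ ∈ F.carrier) (hne : thetaLift μ D χ' Θ ≠ 0)
    (hlaw : ∀ (x κ : GA W), κ ∈ localTorusAt W w → ∀ t,
      Θ t (x * κ) = weightAt W q w 0 κ ^ ePlus * weightAt W q w 1 κ ^ eMinus * Θ t x) :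
    HasKTypeAt W q w ePlus eMinus (thetaSpan F μ D χ') :=
  ⟨_, thetaLift_mem_thetaSpan F μ D χ' hΘ, hne, fun x κ hκ => thetaLift_mul_of_kernel μ D χ' Θ (hlaw x κ hκ)⟩

/-- **`K`-type transfer for the transported torus**: the primed twin of `hasKTypeAt_thetaSpan_of_kernel`. -/
theorem hasKTypeAt'_thetaSpan_of_kernel (F : KernelFamily W) (μ : Measure (torusT' W)) (D : Set (torusT' W))
    (χ' : torusT' W → ℂ) (q : QuadData k) (w : InfinitePlace k) (g g' : Matrix (Fin 4) (Fin 4) k)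
    (ePlus eMinus : ℤ) {Θ : torusT' W → GA W → ℂ} (hΘ : Θ ∈ F.carrier) (hne : thetaLift μ D χ' Θ ≠ 0)
    (hlaw : ∀ (x κ : GA W), κ ∈ localTorusAt' W w → ∀ t,
      Θ t (x * κ) = weightAt' W q w g g' 0 κ ^ ePlus * weightAt' W q w g g' 1 κ ^ eMinus * Θ t x) :
    HasKTypeAt' W q w g g' ePlus eMinus (thetaSpan F μ D χ') :=
  ⟨_, thetaLift_mem_thetaSpan F μ D χ' hΘ, hne, fun x κ hκ => thetaLift_mul_of_kernel μ D χ' Θ (hlaw x κ hκ)⟩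

end Transfer

section Riesz

variable {k : Type} [Field k] [NumberField k] {W : PlaneData k}
  [MeasurableSpace (torusT W)] [MeasurableSpace (torusT' W)] (R : RTFData W) (F : KernelFamily W)

/-- **The Riesz vector from a kernel**: a kernel of the family that is `χ̄′`-equivariant in `g` under right translation
by `T′(𝔸)`, whose lift of `χ̄′` is non-zero at `1`, gives a Riesz vector of `V = thetaSpan F μ_{T′} D_{T′} χ̄′`. -/
theorem isRieszVector_thetaLift {Θ : torusT' W → GA W → ℂ} (hΘ : Θ ∈ F.carrier)
    (hequiv : ∀ (x : GA W) (t' : torusT' W), ∀ t, Θ t (x * t') = conjChar W R.chi' t' * Θ t x)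
    (h1 : thetaLift R.μT' R.DT' (conjChar W R.chi') Θ 1 ≠ 0) :
    IsRieszVector W R (thetaSpan F R.μT' R.DT' (conjChar W R.chi'))
      (thetaLift R.μT' R.DT' (conjChar W R.chi') Θ) :=
  ⟨thetaLift_mem_thetaSpan F _ _ _ hΘ, thetaLift_ne_zero_of_apply_ne_zero _ _ _ _ h1,
    fun x t => thetaLift_mul_of_kernel _ _ _ Θ (hequiv x t), h1⟩

/-- **The two-torus period of a kernel**: `P_χ (s ↦ P_{χ̄′} (t ↦ Θ(t, s)))` — the `Jc`-shaped double period of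
`AdelicRTF` (`RTFData.Jc`) applied to the kernel restricted to `T′(𝔸) × T(𝔸)`. -/
def kernelTwoTorusPeriod (Θ : torusT' W → GA W → ℂ) : ℂ :=
  periodLin W R.μT R.DT R.chi fun s : torusT W =>
    periodLin W R.μT' R.DT' (conjChar W R.chi') fun t => Θ t (s : GA W)

/-- **The restriction of a lift to `T(𝔸)` is the `T′`-period of the kernel, pointwise** (DISPLAYED: integrability of
`t ↦ χ̄′(t) Θ(t, s)` over `D_{T′}` for each `s`, so that the linear period is the integral). -/
theorem restrictTo_thetaLift_eq {Θ : torusT' W → GA W → ℂ}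
    (hint : ∀ s : torusT W, Integrable (fun t => conjChar W R.chi' t * Θ t (s : GA W)) (R.μT'.restrict R.DT')) :
    restrictTo W (torusT W) (thetaLift R.μT' R.DT' (conjChar W R.chi') Θ) =
      fun s : torusT W => periodLin W R.μT' R.DT' (conjChar W R.chi') fun t => Θ t (s : GA W) := by
  funext s
  rw [periodLin_eq_integral W _ _ _ (hint s)]
  simp only [restrictTo, thetaLift, mul_comm]

/-- **The mixed period of a lift is the two-torus period of its kernel** (the seesaw identity of L4-MATH.md §11 at
the level of one kernel; integrability DISPLAYED as in `restrictTo_thetaLift_eq`). -/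
theorem mixedPeriod_thetaLift_eq {Θ : torusT' W → GA W → ℂ}
    (hint : ∀ s : torusT W, Integrable (fun t => conjChar W R.chi' t * Θ t (s : GA W)) (R.μT'.restrict R.DT')) :
    periodLin W R.μT R.DT R.chi (restrictTo W (torusT W) (thetaLift R.μT' R.DT' (conjChar W R.chi') Θ)) =
      kernelTwoTorusPeriod R Θ := by
  rw [restrictTo_thetaLift_eq R hint]
  rfl

end Riesz

section Rungs

variable {k : Type} [Field k] [NumberField k] {W : PlaneData k}
  [MeasurableSpace (torusT W)] [MeasurableSpace (torusT' W)] (R : RTFData W) (F : KernelFamily W)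
  (q : QuadData k) (g g' : Matrix (Fin 4) (Fin 4) k) (w₀ : InfinitePlace k) (eP eM eP' eM' : InfinitePlace k → ℤ)

/-- **The six spectral clauses on the span of the lifts**, from the DISPLAYED printed properties of the family:
(ii) irreducibility of the span (Howe duality), (iii) cuspidality of the span, (iv) at every real place a kernel of
`K`-type `(eP w, eM w)` with non-zero lift, (v) «lowest at `w₀`», (vi)–(vii) the primed twins — plus one non-zero
lift for `V ≠ ⊥`. -/
theorem isAdmissible_thetaSpan
    {Θ₀ : torusT' W → GA W → ℂ} (hΘ₀ : Θ₀ ∈ F.carrier) (hne₀ : thetaLift R.μT' R.DT' (conjChar W R.chi') Θ₀ ≠ 0)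
    (hirr : ∀ V₀ ≤ thetaSpan F R.μT' R.DT' (conjChar W R.chi'), IsAutomorphicSubspace W V₀ →
      V₀ = ⊥ ∨ V₀ = thetaSpan F R.μT' R.DT' (conjChar W R.chi'))
    (hcusp : IsCuspidalSubspace W (thetaSpan F R.μT' R.DT' (conjChar W R.chi')))
    (hK : ∀ w, ∃ Θ ∈ F.carrier, thetaLift R.μT' R.DT' (conjChar W R.chi') Θ ≠ 0 ∧
      ∀ (x κ : GA W), κ ∈ localTorusAt W w → ∀ t,
        Θ t (x * κ) = weightAt W q w 0 κ ^ eP w * weightAt W q w 1 κ ^ eM w * Θ t x)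
    (hlow : ∀ j : ℤ, |(eP w₀ - eM w₀) + 2 * j| < 3 →
      ¬ HasKTypeAt W q w₀ (eP w₀ + j) (eM w₀ - j) (thetaSpan F R.μT' R.DT' (conjChar W R.chi')))
    (hK' : ∀ w, ∃ Θ ∈ F.carrier, thetaLift R.μT' R.DT' (conjChar W R.chi') Θ ≠ 0 ∧
      ∀ (x κ : GA W), κ ∈ localTorusAt' W w → ∀ t,
        Θ t (x * κ) = weightAt' W q w g g' 0 κ ^ eP' w * weightAt' W q w g g' 1 κ ^ eM' w * Θ t x)
    (hlow' : ∀ j : ℤ, |(eP' w₀ - eM' w₀) + 2 * j| < 3 →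
      ¬ HasKTypeAt' W q w₀ g g' (eP' w₀ + j) (eM' w₀ - j) (thetaSpan F R.μT' R.DT' (conjChar W R.chi'))) :
    IsAdmissible W q g g' w₀ eP eM eP' eM' (thetaSpan F R.μT' R.DT' (conjChar W R.chi')) := by
  refine ⟨isIrreducibleAutomorphic_thetaSpan F _ _ _ hΘ₀ hne₀ hirr, hcusp, fun w => ?_, hlow, fun w => ?_, hlow'⟩
  · obtain ⟨Θ, hΘ, hne, hlaw⟩ := hK w
    exact hasKTypeAt_thetaSpan_of_kernel F _ _ _ q w (eP w) (eM w) hΘ hne hlaw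
  · obtain ⟨Θ, hΘ, hne, hlaw⟩ := hK' w
    exact hasKTypeAt'_thetaSpan_of_kernel F _ _ _ q w g g' (eP' w) (eM' w) hΘ hne hlaw

/-- **RUNG W1 on the theta vocabulary** — the EXISTENCE of an admissible `V` with a Riesz vector, from the DISPLAYED
printed properties of a kernel family: (i) a `χ̄′`-equivariant kernel with `θ(χ̄′)(1) ≠ 0` (the Riesz vector;
Siegel–Weil / Rallis), (ii) Howe duality (irreducibility of the span), (iii) cuspidality of the span, (iv)/(vi) the
`K`-types at every real place read on kernels (Ichino Lemma 7.8 / `LitKType`), (v)/(vii) «lowest at `w₀`» for the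
span.  The conclusion is the cut's W1 verbatim (`exists_admissible_riesz_of_mixed` of `TwoTorusCut`). -/
theorem exists_admissible_riesz_of_kernelFamily
    (hriesz : ∃ Θ ∈ F.carrier, (∀ (x : GA W) (t' : torusT' W), ∀ t, Θ t (x * t') = conjChar W R.chi' t' * Θ t x) ∧
      thetaLift R.μT' R.DT' (conjChar W R.chi') Θ 1 ≠ 0)
    (hirr : ∀ V₀ ≤ thetaSpan F R.μT' R.DT' (conjChar W R.chi'), IsAutomorphicSubspace W V₀ →
      V₀ = ⊥ ∨ V₀ = thetaSpan F R.μT' R.DT' (conjChar W R.chi'))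
    (hcusp : IsCuspidalSubspace W (thetaSpan F R.μT' R.DT' (conjChar W R.chi')))
    (hK : ∀ w, ∃ Θ ∈ F.carrier, thetaLift R.μT' R.DT' (conjChar W R.chi') Θ ≠ 0 ∧
      ∀ (x κ : GA W), κ ∈ localTorusAt W w → ∀ t,
        Θ t (x * κ) = weightAt W q w 0 κ ^ eP w * weightAt W q w 1 κ ^ eM w * Θ t x)
    (hlow : ∀ j : ℤ, |(eP w₀ - eM w₀) + 2 * j| < 3 →
      ¬ HasKTypeAt W q w₀ (eP w₀ + j) (eM w₀ - j) (thetaSpan F R.μT' R.DT' (conjChar W R.chi')))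
    (hK' : ∀ w, ∃ Θ ∈ F.carrier, thetaLift R.μT' R.DT' (conjChar W R.chi') Θ ≠ 0 ∧
      ∀ (x κ : GA W), κ ∈ localTorusAt' W w → ∀ t,
        Θ t (x * κ) = weightAt' W q w g g' 0 κ ^ eP' w * weightAt' W q w g g' 1 κ ^ eM' w * Θ t x)
    (hlow' : ∀ j : ℤ, |(eP' w₀ - eM' w₀) + 2 * j| < 3 →
      ¬ HasKTypeAt' W q w₀ g g' (eP' w₀ + j) (eM' w₀ - j) (thetaSpan F R.μT' R.DT' (conjChar W R.chi'))) :
    ∃ V : Submodule ℂ (GA W → ℂ), IsAdmissible W q g g' w₀ eP eM eP' eM' V ∧ ∃ f, IsRieszVector W R V f := by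
  obtain ⟨Θ, hΘ, hequiv, h1⟩ := hriesz
  exact ⟨thetaSpan F R.μT' R.DT' (conjChar W R.chi'),
    isAdmissible_thetaSpan R F q g g' w₀ eP eM eP' eM' hΘ (thetaLift_ne_zero_of_apply_ne_zero _ _ _ _ h1) hirr hcusp
      hK hlow hK' hlow',
    _, isRieszVector_thetaLift R F hΘ hequiv h1⟩

/-- **RUNG W3 on the theta vocabulary** — the SIMULTANEOUS clause: as W1, with (i) strengthened to a `χ̄′`-equivariant
kernel with `θ(χ̄′)(1) ≠ 0` AND non-zero `T`-period of its lift against `χ` (by `mixedPeriod_thetaLift_eq`, the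
two-torus period of the kernel).  The conclusion is the cut's W3 verbatim. -/
theorem exists_admissible_mixed_of_kernelFamily
    (hmixed : ∃ Θ ∈ F.carrier, (∀ (x : GA W) (t' : torusT' W), ∀ t, Θ t (x * t') = conjChar W R.chi' t' * Θ t x) ∧
      thetaLift R.μT' R.DT' (conjChar W R.chi') Θ 1 ≠ 0 ∧
      periodLin W R.μT R.DT R.chi (restrictTo W (torusT W) (thetaLift R.μT' R.DT' (conjChar W R.chi') Θ)) ≠ 0)
    (hirr : ∀ V₀ ≤ thetaSpan F R.μT' R.DT' (conjChar W R.chi'), IsAutomorphicSubspace W V₀ →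
      V₀ = ⊥ ∨ V₀ = thetaSpan F R.μT' R.DT' (conjChar W R.chi'))
    (hcusp : IsCuspidalSubspace W (thetaSpan F R.μT' R.DT' (conjChar W R.chi')))
    (hK : ∀ w, ∃ Θ ∈ F.carrier, thetaLift R.μT' R.DT' (conjChar W R.chi') Θ ≠ 0 ∧
      ∀ (x κ : GA W), κ ∈ localTorusAt W w → ∀ t,
        Θ t (x * κ) = weightAt W q w 0 κ ^ eP w * weightAt W q w 1 κ ^ eM w * Θ t x)
    (hlow : ∀ j : ℤ, |(eP w₀ - eM w₀) + 2 * j| < 3 →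
      ¬ HasKTypeAt W q w₀ (eP w₀ + j) (eM w₀ - j) (thetaSpan F R.μT' R.DT' (conjChar W R.chi')))
    (hK' : ∀ w, ∃ Θ ∈ F.carrier, thetaLift R.μT' R.DT' (conjChar W R.chi') Θ ≠ 0 ∧
      ∀ (x κ : GA W), κ ∈ localTorusAt' W w → ∀ t,
        Θ t (x * κ) = weightAt' W q w g g' 0 κ ^ eP' w * weightAt' W q w g g' 1 κ ^ eM' w * Θ t x)
    (hlow' : ∀ j : ℤ, |(eP' w₀ - eM' w₀) + 2 * j| < 3 →
      ¬ HasKTypeAt' W q w₀ g g' (eP' w₀ + j) (eM' w₀ - j) (thetaSpan F R.μT' R.DT' (conjChar W R.chi'))) :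
    ∃ V : Submodule ℂ (GA W → ℂ), IsAdmissible W q g g' w₀ eP eM eP' eM' V ∧ HasNonzeroMixedPeriod W R V := by
  obtain ⟨Θ, hΘ, hequiv, h1, hper⟩ := hmixed
  exact ⟨thetaSpan F R.μT' R.DT' (conjChar W R.chi'),
    isAdmissible_thetaSpan R F q g g' w₀ eP eM eP' eM' hΘ (thetaLift_ne_zero_of_apply_ne_zero _ _ _ _ h1) hirr hcusp
      hK hlow hK' hlow',
    _, isRieszVector_thetaLift R F hΘ hequiv h1, hper⟩

/-- **The wall's conclusion from a kernel family** (through the cut's glue `exists_spectrum_of_rungs`; `hR`, `hunit` as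
in the cut): the six spectral clauses, `P_{χ′} ≠ 0` on `V`, and the `χ̄′`-equivariant `f ∈ V` with non-zero `T`-period,
for `V` the span of the lifts. -/
theorem exists_spectrum_of_kernelFamily (hR : R.IsHaar) (hunit : ∀ t, ‖R.chi' t‖ = 1)
    (hmixed : ∃ Θ ∈ F.carrier, (∀ (x : GA W) (t' : torusT' W), ∀ t, Θ t (x * t') = conjChar W R.chi' t' * Θ t x) ∧
      thetaLift R.μT' R.DT' (conjChar W R.chi') Θ 1 ≠ 0 ∧
      periodLin W R.μT R.DT R.chi (restrictTo W (torusT W) (thetaLift R.μT' R.DT' (conjChar W R.chi') Θ)) ≠ 0)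
    (hirr : ∀ V₀ ≤ thetaSpan F R.μT' R.DT' (conjChar W R.chi'), IsAutomorphicSubspace W V₀ →
      V₀ = ⊥ ∨ V₀ = thetaSpan F R.μT' R.DT' (conjChar W R.chi'))
    (hcusp : IsCuspidalSubspace W (thetaSpan F R.μT' R.DT' (conjChar W R.chi')))
    (hK : ∀ w, ∃ Θ ∈ F.carrier, thetaLift R.μT' R.DT' (conjChar W R.chi') Θ ≠ 0 ∧
      ∀ (x κ : GA W), κ ∈ localTorusAt W w → ∀ t,
        Θ t (x * κ) = weightAt W q w 0 κ ^ eP w * weightAt W q w 1 κ ^ eM w * Θ t x)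
    (hlow : ∀ j : ℤ, |(eP w₀ - eM w₀) + 2 * j| < 3 →
      ¬ HasKTypeAt W q w₀ (eP w₀ + j) (eM w₀ - j) (thetaSpan F R.μT' R.DT' (conjChar W R.chi')))
    (hK' : ∀ w, ∃ Θ ∈ F.carrier, thetaLift R.μT' R.DT' (conjChar W R.chi') Θ ≠ 0 ∧
      ∀ (x κ : GA W), κ ∈ localTorusAt' W w → ∀ t,
        Θ t (x * κ) = weightAt' W q w g g' 0 κ ^ eP' w * weightAt' W q w g g' 1 κ ^ eM' w * Θ t x)
    (hlow' : ∀ j : ℤ, |(eP' w₀ - eM' w₀) + 2 * j| < 3 →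
      ¬ HasKTypeAt' W q w₀ g g' (eP' w₀ + j) (eM' w₀ - j) (thetaSpan F R.μT' R.DT' (conjChar W R.chi'))) :
    ∃ V : Submodule ℂ (GA W → ℂ),
      IsIrreducibleAutomorphic W V ∧
      IsCuspidalSubspace W V ∧
      (∀ w, HasKTypeAt W q w (eP w) (eM w) V) ∧
      (∀ j : ℤ, |(eP w₀ - eM w₀) + 2 * j| < 3 → ¬ HasKTypeAt W q w₀ (eP w₀ + j) (eM w₀ - j) V) ∧
      (∀ w, HasKTypeAt' W q w g g' (eP' w) (eM' w) V) ∧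
      (∀ j : ℤ, |(eP' w₀ - eM' w₀) + 2 * j| < 3 → ¬ HasKTypeAt' W q w₀ g g' (eP' w₀ + j) (eM' w₀ - j) V) ∧
      HasNonzeroToricPeriod W R.μT' R.DT' R.chi' V ∧
      ∃ f ∈ V, f ≠ 0 ∧
        (∀ (x : GA W) (t : torusT' W), f (x * t) = conjChar W R.chi' t * f x) ∧
        periodLin W R.μT R.DT R.chi (restrictTo W (torusT W) f) ≠ 0 :=
  exists_spectrum_of_rungs W R hR hunit q g g' w₀ eP eM eP' eM'
    (exists_admissible_mixed_of_kernelFamily R F q g g' w₀ eP eM eP' eM' hmixed hirr hcusp hK hlow hK' hlow')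

end Rungs

end Summit.Ventures.HodgeRepro.Tier4.Line4

end
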